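import Summits.MatrixMultiplication.MatrixMultiplication.Theorems.PrimeLogDecay.Negative.ChainMenuDesign

/-! Triage check (idea forced-refactorization-rigidity): a length-2 chain menu in `ZMod 7` whose two
letters have DIFFERENT difference sets.  By the landed coupling theorem the product blocks over any
antichain word family form an SDPP family in `(ZMod 7)^k`; with the weight-`k/2` words it is balanced
(`s = 5^{k/2}`), beyond the wall for `k ≥ 4` (`n s²/N = C(k,k/2)·(25/49)^{k/2} → ∞`), and NOT
equi-difference: `A_w − B_w = ∏ D^{(w_t)}` with `D⁰ = {2,…,6} ≠ D¹ = {1,…,5}`, pairwise overlaps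
`(4/5)^{#differing coords}·s²`. -/

open Summit.MatrixMultiplication.MatrixMultiplication.Theorems.PrimeLogDecay.Negative
open scoped Pointwise

namespace TriageIdea6

def twoR : Fin 2 → Finset (ZMod 7) := ![{0}, {1, 2, 3, 4, 5}]
def twoR' : Fin 2 → Finset (ZMod 7) := ![{1, 2, 3, 4, 5}, {0}]

lemma two_direct : ∀ a : Fin 2, ∀ x ∈ twoR a, ∀ x' ∈ twoR a, ∀ y ∈ twoR' a, ∀ y' ∈ twoR' a,
    x - x' + (y - y') = 0 → x = x' ∧ y = y' := by decide

lemma two_chain : ∀ a b c : Fin 2, a < b → Disjoint (twoR a + twoR' c) (twoR c + twoR' b) := by decide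

/-- the two letters have different difference sets (so product designs are not equi-difference) -/
lemma two_nonEqui : twoR 0 - twoR' 0 ≠ twoR 1 - twoR' 1 := by decide

lemma two_diff0 : twoR 0 - twoR' 0 = {2, 3, 4, 5, 6} := by decide
lemma two_diff1 : twoR 1 - twoR' 1 = {1, 2, 3, 4, 5} := by decide
lemma two_overlap : ((twoR 0 - twoR' 0) ∩ (twoR 1 - twoR' 1)).card = 4 := by decide

/-- SDPP product designs in `(ZMod 7)^k` from the non-equi-difference menu. -/
theorem isSDPP_two_pi {n k : ℕ} (w : Fin n → (Fin k → Fin 2))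
    (hsep : ∀ i i' : Fin n, i ≠ i' → ∃ t, w i t < w i' t) :
    Literature.Computability.AlgebraicComplexity.IsSDPP
      (fun i => Fintype.piFinset fun t => twoR (w i t))
      (fun i => Fintype.piFinset fun t => twoR' (w i t)) :=
  isSDPP_pi_of_chainMenu twoR twoR' two_direct two_chain w hsep

/-- Wall ratios `n s²/N = C(k,k/2)·25^{k/2}/7^k` (weight-`k/2` words): `3750/2401 ≈ 1.56` (k=4),
`312500/117649 ≈ 2.66` (k=6), then `4.74, 8.71, 16.3, 30.9` for k = 8, 10, 12, 14 (computed with `#eval`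
in the folder copy; `#eval` is not allowed in crux workfiles).  Two instances, kernel-checked: -/
example : (3 : ℚ) / 2 < (Nat.choose 4 2 * 5 ^ 2 * 5 ^ 2 : ℚ) / 7 ^ 4 := by norm_num [Nat.choose]
example : (5 : ℚ) / 2 < (Nat.choose 6 3 * 5 ^ 3 * 5 ^ 3 : ℚ) / 7 ^ 6 := by norm_num [Nat.choose]
example : (30 : ℚ) < (Nat.choose 14 7 * 5 ^ 7 * 5 ^ 7 : ℚ) / 7 ^ 14 := by norm_num [Nat.choose]

end TriageIdea6
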